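import Literature.AnabelianGeometry.SemiGraphs.GraphCoveringDegreeOne
import Literature.AnabelianGeometry.SemiGraphs.FibredSemiGraph

/-!
# The lift of a proper morphism to a total semi-graph determined by compatible labels
# ([SemiAnbd] §1 p. 14, §2 p. 23)

Mochizuki, *Semi-graphs of anabelioids*, Publ. RIMS **42** (2006) 221–322, §1 p. 14 (graph-coverings)
and §2 p. 23 (the semi-graph `𝔾′` of the finite étale covering attached to `G′ ∈ B(𝒢)`: vertices and
edges over `v`, `e` ARE the connected components of `S_v`, `T_e`, a branch `(b, Q)` abutting to
`(v, P)` for the component `P` under which `Q` lies) [cite: MochizukiSemiAnbd2006, Def. 2.2(i) p.23].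

PROOF-ONLY combinatorics (abc-iut cell, layer L3; FACT-LIST row F-1478 `remark_2_4_1_covering`, brick
**(T-δ)** of `HOME/staging/f/f-161/J1-TIE-ROUTE.md`, the «tie» of the dictionary facts (D2)/(D3); seat
abc-iut-f-161).  Pure semi-graph theory over abc-iut-L3-t5's `SemiGraph.FibreData` (`FibredSemiGraph`):
a proper morphism `π′ : 𝔾′ → 𝕂` together with LABELS `ℓV w ∈ F(π′ w)`, `ℓE e′ ∈ F(π′ e′)` in fibre
data `D` over `𝕂` that are compatible with abutment (the label of the edge of a branch `b′` at `w`
specialises, along `π′ b′`, to the label of `w`) determines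

* `exists_hom_total_of_labels` — a morphism `Θ : 𝔾′ → D.total` over `𝕂` with `Θ w = (π′ w, ℓV w)`,
  `Θ e′ = (π′ e′, ℓE e′)`; it is proper (`isProper_of_comp_proj_eq`);
* `isExcision_of_labels` — `Θ` is an excision as soon as, at every vertex `w` and over every branch
  `b` of `𝕂` at `π′ w`, distinct branches at `w` over `b` carry distinct edge labels and there are at
  least as many such branches as components attached to `ℓV w` over `b`;
* `labels_bijective` — **if moreover `D.total` is connected and the fibres of `π′` have the
  cardinalities `#F(u)`, `#F(e)` of the fibre data, then `w ↦ (π′ w, ℓV w)` and `e′ ↦ (π′ e′, ℓE e′)`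
  are BIJECTIONS** (`IsGraphCovering.bijective_of_natCard_fiber_eq`, abc-iut-f-161 (T-γ)).

Consumer: the canonical labelling of a four-clause finite étale covering `ℋ → 𝒦` of `A` by the
components of `A_u`, `A_e` holding the global base points (`TieBijective`).  No `def`, no `Prop`
introduced; nothing here takes a side on [IUTchIII] Cor. 3.12.
-/

namespace Literature.AnabelianGeometry.SemiGraphs

namespace SemiGraph

namespace FibreData

open CategoryTheory

universe u

variable {G' K : SemiGraph.{u}} (π' : G' ⟶ K) (D : K.FibreData)
  (ℓV : ∀ w : G'.Vertex, D.FV (π'.vertexMap w)) (ℓE : ∀ e' : G'.Edge, D.FE (π'.edgeMap e'))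

/-! ### The labelled lift `Θ : 𝔾′ → D.total` -/

/-- `Option.pbind` of a `some`-valued function at a `some`. [folklore] -/
private theorem pbind_some_eq {ι κ : Type*} {o : Option ι} {a : ι} (ho : o = some a)
    (f : ∀ x : ι, x ∈ o → κ) :
    (o.pbind fun x hx => some (f x hx)) = some (f a (Option.mem_def.mpr ho)) := by
  subst ho
  rfl

/-- The abutment of a decorated branch `(b, c)` of `D.total` over a branch `b` abutting to `u`: it
abuts to `(u, σ_b c)`. [cite: MochizukiSemiAnbd2006, Def. 2.2(i) p.23] -/
theorem total_abuts_eq {b : K.Branch} {u : K.Vertex} (hb : K.abuts b = some u)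
    (c : D.FE (K.edgeOf b)) :
    D.total.abuts ⟨b, c⟩ = some ⟨u, D.σ b u hb c⟩ :=
  pbind_some_eq hb fun v hv => (⟨v, D.σ b v (Option.mem_def.mp hv) c⟩ : D.total.Vertex)

/-- Conversely, if the decorated branch `(b, c)` abuts to `(u, x)` then `b` abuts to `u` and
`σ_b c = x`. [cite: MochizukiSemiAnbd2006, Def. 2.2(i) p.23] -/
theorem of_total_abuts_eq {b : K.Branch} (c : D.FE (K.edgeOf b)) {u : K.Vertex} {x : D.FV u}
    (h : D.total.abuts ⟨b, c⟩ = some ⟨u, x⟩) :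
    ∃ hb : K.abuts b = some u, D.σ b u hb c = x := by
  have hb : K.abuts b = some u := D.proj.abuts_branchMap ⟨b, c⟩ ⟨u, x⟩ h
  refine ⟨hb, ?_⟩
  rw [D.total_abuts_eq hb c, Option.some.injEq] at h
  exact eq_of_heq (Sigma.mk.inj_iff.mp h).2

/-- **The labelled lift.**  Labels `ℓV`, `ℓE` over a morphism `π′ : 𝔾′ → 𝕂` that are compatible with
abutment — for a branch `b′` at `w`, the label of the edge of `b′` specialises along `π′ b′` to the
label of `w` — are the vertex and edge maps of a morphism `Θ : 𝔾′ → D.total` over `𝕂`, sending a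
branch `b′` to `(π′ b′, ℓE(e(b′)))`. [cite: MochizukiSemiAnbd2006, Def. 2.2(i) p.23] -/
theorem exists_hom_total_of_labels
    (hcompat : ∀ (b' : G'.Branch) (w : G'.Vertex) (h' : G'.abuts b' = some w),
      D.σ (π'.branchMap b') (π'.vertexMap w) (π'.abuts_branchMap b' w h')
        (cast (congrArg D.FE (π'.edgeOf_branchMap b').symm) (ℓE (G'.edgeOf b'))) = ℓV w) :
    ∃ Θ : G' ⟶ D.total, Θ ≫ D.proj = π' ∧
      (∀ w, Θ.vertexMap w = ⟨π'.vertexMap w, ℓV w⟩) ∧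
      (∀ e', Θ.edgeMap e' = ⟨π'.edgeMap e', ℓE e'⟩) ∧
      ∀ b', Θ.branchMap b' =
        ⟨π'.branchMap b', cast (congrArg D.FE (π'.edgeOf_branchMap b').symm) (ℓE (G'.edgeOf b'))⟩ := by
  refine ⟨{ vertexMap := fun w => ⟨π'.vertexMap w, ℓV w⟩
            edgeMap := fun e' => ⟨π'.edgeMap e', ℓE e'⟩
            branchMap := fun b' =>
              ⟨π'.branchMap b', cast (congrArg D.FE (π'.edgeOf_branchMap b').symm) (ℓE (G'.edgeOf b'))⟩
            edgeOf_branchMap := fun b' => ?_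
            branchMap_injOn := fun b₁ b₂ he hb => ?_
            abuts_branchMap := fun b' w h' => ?_ }, ?_, fun _ => rfl, fun _ => rfl, fun _ => rfl⟩
  · -- `edgeOf (π′ b′, ℓE) = (π′ e(b′), ℓE)`
    change (⟨K.edgeOf (π'.branchMap b'), cast _ (ℓE (G'.edgeOf b'))⟩ : D.total.Edge) = _
    ext
    · exact π'.edgeOf_branchMap b'
    · exact cast_heq _ _
  · exact π'.branchMap_injOn b₁ b₂ he (congrArg Sigma.fst hb)
  · rw [D.total_abuts_eq (π'.abuts_branchMap b' w h'), hcompat b' w h']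
  · exact SemiGraph.hom_ext _ _ rfl rfl rfl

/-- A morphism over `𝕂` into `D.total` lifting a PROPER `π′` is proper (the projection of the total
semi-graph preserves verticial cardinalities on the nose). [cite: MochizukiSemiAnbd2006, §1 p.14] -/
theorem isProper_of_comp_proj_eq (hπ' : IsProper π') (Θ : G' ⟶ D.total) (hΘ : Θ ≫ D.proj = π') :
    IsProper Θ := by
  intro e'
  rw [D.vertCard_total, ← hπ' e']
  exact congrArg K.vertCard (congrArg (fun f : G' ⟶ K => f.edgeMap e') hΘ)

/-! ### Fibres over `𝕂` -/

/-- The fibre of the projection `D.total → 𝕂` over `u` is `F(u)`: cardinalities.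
[cite: MochizukiSemiAnbd2006, Def. 2.2(i) p.23] -/
theorem natCard_vertexFiber_proj (u : K.Vertex) :
    Nat.card (D.proj.VertexFiber u) = Nat.card (D.FV u) :=
  Nat.card_congr (D.fibreVertexEquiv u)

/-- The fibre of the projection `D.total → 𝕂` over `e` is `F(e)`: cardinalities.
[cite: MochizukiSemiAnbd2006, Def. 2.2(i) p.23] -/
theorem natCard_edgeFiber_proj (e : K.Edge) :
    Nat.card (D.proj.EdgeFiber e) = Nat.card (D.FE e) :=
  Nat.card_congr (D.fibreEdgeEquiv e)

/-- A labelling of the vertices of `𝔾′` by the fibre data which is BIJECTIVE as a map to `Σ u, F(u)`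
identifies the fibre of `π′` over `u` with `F(u)` (used with the LOCAL labels of a finite étale
covering). [cite: MochizukiSemiAnbd2006, Def. 2.2(i) p.23] -/
theorem nonempty_vertexFiber_equiv_of_bijective (cV : ∀ w : G'.Vertex, D.FV (π'.vertexMap w))
    (hcV : Function.Bijective fun w : G'.Vertex => (⟨π'.vertexMap w, cV w⟩ : Σ u, D.FV u))
    (u : K.Vertex) : Nonempty (π'.VertexFiber u ≃ D.FV u) := by
  let Φ := Equiv.ofBijective _ hcV
  refine ⟨{ toFun := fun w => cast (congrArg D.FV w.2) (cV w.1)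
            invFun := fun c => ⟨Φ.symm ⟨u, c⟩, ?_⟩
            left_inv := fun w => ?_
            right_inv := fun c => ?_ }⟩
  · have h := Φ.apply_symm_apply ⟨u, c⟩
    exact congrArg Sigma.fst h
  · apply Subtype.ext
    change Φ.symm ⟨u, cast _ (cV w.1)⟩ = w.1
    rw [Equiv.symm_apply_eq]
    change _ = (⟨π'.vertexMap w.1, cV w.1⟩ : Σ u, D.FV u)
    ext
    · exact w.2.symm
    · exact cast_heq _ _
  · have h := Φ.apply_symm_apply ⟨u, c⟩
    change (⟨π'.vertexMap (Φ.symm ⟨u, c⟩), cV (Φ.symm ⟨u, c⟩)⟩ : Σ u, D.FV u) = ⟨u, c⟩ at h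
    exact eq_of_heq ((cast_heq _ _).trans (Sigma.mk.inj_iff.mp h).2)

/-- Edge version of `nonempty_vertexFiber_equiv_of_bijective`. [cite: MochizukiSemiAnbd2006, Def. 2.2(i) p.23] -/
theorem nonempty_edgeFiber_equiv_of_bijective (cE : ∀ e' : G'.Edge, D.FE (π'.edgeMap e'))
    (hcE : Function.Bijective fun e' : G'.Edge => (⟨π'.edgeMap e', cE e'⟩ : Σ e, D.FE e))
    (e : K.Edge) : Nonempty (π'.EdgeFiber e ≃ D.FE e) := by
  let Φ := Equiv.ofBijective _ hcE
  refine ⟨{ toFun := fun e' => cast (congrArg D.FE e'.2) (cE e'.1)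
            invFun := fun c => ⟨Φ.symm ⟨e, c⟩, ?_⟩
            left_inv := fun e' => ?_
            right_inv := fun c => ?_ }⟩
  · have h := Φ.apply_symm_apply ⟨e, c⟩
    exact congrArg Sigma.fst h
  · apply Subtype.ext
    change Φ.symm ⟨e, cast _ (cE e'.1)⟩ = e'.1
    rw [Equiv.symm_apply_eq]
    change _ = (⟨π'.edgeMap e'.1, cE e'.1⟩ : Σ e, D.FE e)
    ext
    · exact e'.2.symm
    · exact cast_heq _ _
  · have h := Φ.apply_symm_apply ⟨e, c⟩
    change (⟨π'.edgeMap (Φ.symm ⟨e, c⟩), cE (Φ.symm ⟨e, c⟩)⟩ : Σ e, D.FE e) = ⟨e, c⟩ at h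
    exact eq_of_heq ((cast_heq _ _).trans (Sigma.mk.inj_iff.mp h).2)

/-! ### Excision from injectivity on stars and a count -/

/-- The edge label of a branch, as a point of `Σ e, F(e)`: two branches over the same branch of `𝕂`
with the same decorated image in `D.total` have the same such label. [folklore] -/
private theorem sigma_label_eq_of_branchMap_eq {b'₁ b'₂ : G'.Branch}
    (hπ : π'.branchMap b'₁ = π'.branchMap b'₂)
    (h : HEq (cast (congrArg D.FE (π'.edgeOf_branchMap b'₁).symm) (ℓE (G'.edgeOf b'₁)))
      (cast (congrArg D.FE (π'.edgeOf_branchMap b'₂).symm) (ℓE (G'.edgeOf b'₂)))) :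
    (⟨π'.edgeMap (G'.edgeOf b'₁), ℓE (G'.edgeOf b'₁)⟩ : Σ e, D.FE e) =
      ⟨π'.edgeMap (G'.edgeOf b'₂), ℓE (G'.edgeOf b'₂)⟩ := by
  ext
  · change π'.edgeMap (G'.edgeOf b'₁) = π'.edgeMap (G'.edgeOf b'₂)
    rw [← π'.edgeOf_branchMap, ← π'.edgeOf_branchMap, hπ]
  · exact ((cast_heq _ _).symm.trans h).trans (cast_heq _ _)

/-- **Excision from labels.**  Let `Θ` be the labelled lift.  Suppose that at every vertex `w`:
(i) two branches at `w` over the same branch of `𝕂` with the same edge label (in `Σ e, F(e)`) are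
equal, and (ii) over every branch `b` of `𝕂` at `π′ w`, the components over the edge of `b` attached to
`ℓV w` are at most as many as the branches at `w` over `b`.  Then `Θ` is an excision (bijective on
stars). [cite: MochizukiSemiAnbd2006, §1 p.14] -/
theorem isExcision_of_labels [∀ e, Finite (D.FE e)]
    (hcompat : ∀ (b' : G'.Branch) (w : G'.Vertex) (h' : G'.abuts b' = some w),
      D.σ (π'.branchMap b') (π'.vertexMap w) (π'.abuts_branchMap b' w h')
        (cast (congrArg D.FE (π'.edgeOf_branchMap b').symm) (ℓE (G'.edgeOf b'))) = ℓV w)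
    (hinj : ∀ (w : G'.Vertex) (b'₁ b'₂ : G'.Branch), G'.abuts b'₁ = some w → G'.abuts b'₂ = some w →
      π'.branchMap b'₁ = π'.branchMap b'₂ →
      (⟨π'.edgeMap (G'.edgeOf b'₁), ℓE (G'.edgeOf b'₁)⟩ : Σ e, D.FE e) =
        ⟨π'.edgeMap (G'.edgeOf b'₂), ℓE (G'.edgeOf b'₂)⟩ → b'₁ = b'₂)
    (hcard : ∀ (w : G'.Vertex) (b : K.Branch) (hb : K.abuts b = some (π'.vertexMap w)),
      Nat.card {c : D.FE (K.edgeOf b) // D.σ b (π'.vertexMap w) hb c = ℓV w} ≤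
        Nat.card {b' : G'.Branch // G'.abuts b' = some w ∧ π'.branchMap b' = b})
    (Θ : G' ⟶ D.total) (hΘV : ∀ w, Θ.vertexMap w = ⟨π'.vertexMap w, ℓV w⟩)
    (hΘB : ∀ b', Θ.branchMap b' =
      ⟨π'.branchMap b', cast (congrArg D.FE (π'.edgeOf_branchMap b').symm) (ℓE (G'.edgeOf b'))⟩) :
    IsExcision Θ := by
  classical
  intro w
  -- the star map in coordinates
  have hstar : ∀ b' : G'.Star w, (Hom.starMap Θ w b').1 =
      ⟨π'.branchMap b'.1, cast (congrArg D.FE (π'.edgeOf_branchMap b'.1).symm) (ℓE (G'.edgeOf b'.1))⟩ :=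
    fun b' => hΘB b'.1
  -- injectivity
  have hinjective : Function.Injective (Hom.starMap Θ w) := by
    intro b'₁ b'₂ h
    have h1 := congrArg Subtype.val h
    rw [hstar, hstar] at h1
    apply Subtype.ext
    exact hinj w b'₁.1 b'₂.1 b'₁.2 b'₂.2 (congrArg Sigma.fst h1)
      (sigma_label_eq_of_branchMap_eq π' D ℓE (congrArg Sigma.fst h1) (Sigma.mk.inj_iff.mp h1).2)
  refine ⟨hinjective, ?_⟩
  -- surjectivity, slice by slice over the branches `b` of `𝕂` at `π′ w`
  intro bc
  obtain ⟨⟨b, c⟩, hbc⟩ := bc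
  have hbc' : D.total.abuts ⟨b, c⟩ = some ⟨π'.vertexMap w, ℓV w⟩ := by rw [← hΘV w]; exact hbc
  obtain ⟨hb, hσ⟩ := D.of_total_abuts_eq c hbc'
  -- the slice over `b`: branches at `w` over `b` → components over `e(b)` attached to `ℓV w`
  let S := {b' : G'.Branch // G'.abuts b' = some w ∧ π'.branchMap b' = b}
  let T := {c : D.FE (K.edgeOf b) // D.σ b (π'.vertexMap w) hb c = ℓV w}
  have hcast : ∀ b' : S, π'.edgeMap (G'.edgeOf b'.1) = K.edgeOf b := fun b' => by
    rw [← π'.edgeOf_branchMap, b'.2.2]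
  let lab : S → T := fun b' => ⟨cast (congrArg D.FE (hcast b')) (ℓE (G'.edgeOf b'.1)), by
    obtain ⟨b', hb'w, hb'b⟩ := b'
    subst hb'b
    have h := hcompat b' w hb'w
    exact h⟩
  have hlab_inj : Function.Injective lab := by
    intro b'₁ b'₂ h
    have h1 : HEq (cast (congrArg D.FE (hcast b'₁)) (ℓE (G'.edgeOf b'₁.1)))
        (cast (congrArg D.FE (hcast b'₂)) (ℓE (G'.edgeOf b'₂.1))) := heq_of_eq (congrArg Subtype.val h)
    apply Subtype.ext
    refine hinj w b'₁.1 b'₂.1 b'₁.2.1 b'₂.2.1 (b'₁.2.2.trans b'₂.2.2.symm) ?_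
    ext
    · exact (hcast b'₁).trans (hcast b'₂).symm
    · exact ((cast_heq _ _).symm.trans h1).trans (cast_heq _ _)
  haveI : Finite T := inferInstance
  haveI : Finite S := Finite.of_injective lab hlab_inj
  have hle : Nat.card T ≤ Nat.card S := hcard w b hb
  have hbij : Function.Bijective lab := hlab_inj.bijective_of_nat_card_le hle
  obtain ⟨⟨b', hb'w, hb'b⟩, hlab⟩ := hbij.2 ⟨c, hσ⟩
  refine ⟨⟨b', hb'w⟩, Subtype.ext ?_⟩
  rw [hstar]
  change (⟨π'.branchMap b', _⟩ : D.total.Branch) = ⟨b, c⟩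
  subst hb'b
  have hc := congrArg Subtype.val hlab
  change cast _ (ℓE (G'.edgeOf b')) = c at hc
  ext
  · rfl
  · exact ((cast_heq _ _).trans (cast_heq _ _).symm).trans (heq_of_eq hc)

/-! ### Bijectivity of the labels -/

/-- **The labels are bijections.**  Let `π′ : 𝔾′ → 𝕂` be proper, with labels `ℓV`, `ℓE` in fibre data
`D` compatible with abutment, injective on stars with the star count of `isExcision_of_labels`;
suppose `D.total` is CONNECTED and the fibres of `π′` over every vertex `u` and edge `e` of `𝕂` are in
bijection with `F(u)`, `F(e)`.  Then `w ↦ (π′ w, ℓV w)` and `e′ ↦ (π′ e′, ℓE e′)` are bijective: the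
labelled lift `Θ : 𝔾′ → D.total` is a graph-covering over `𝕂` of a connected semi-graph with the base's
fibre cardinalities, hence of degree one (`IsGraphCovering.bijective_of_natCard_fiber_eq`).
[cite: MochizukiSemiAnbd2006, §1 p.14] -/
theorem labels_bijective [∀ u, Finite (D.FV u)] [∀ e, Finite (D.FE e)] (hπ' : IsProper π')
    (hcompat : ∀ (b' : G'.Branch) (w : G'.Vertex) (h' : G'.abuts b' = some w),
      D.σ (π'.branchMap b') (π'.vertexMap w) (π'.abuts_branchMap b' w h')
        (cast (congrArg D.FE (π'.edgeOf_branchMap b').symm) (ℓE (G'.edgeOf b'))) = ℓV w)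
    (hinj : ∀ (w : G'.Vertex) (b'₁ b'₂ : G'.Branch), G'.abuts b'₁ = some w → G'.abuts b'₂ = some w →
      π'.branchMap b'₁ = π'.branchMap b'₂ →
      (⟨π'.edgeMap (G'.edgeOf b'₁), ℓE (G'.edgeOf b'₁)⟩ : Σ e, D.FE e) =
        ⟨π'.edgeMap (G'.edgeOf b'₂), ℓE (G'.edgeOf b'₂)⟩ → b'₁ = b'₂)
    (hcard : ∀ (w : G'.Vertex) (b : K.Branch) (hb : K.abuts b = some (π'.vertexMap w)),
      Nat.card {c : D.FE (K.edgeOf b) // D.σ b (π'.vertexMap w) hb c = ℓV w} ≤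
        Nat.card {b' : G'.Branch // G'.abuts b' = some w ∧ π'.branchMap b' = b})
    (hconn : D.total.IsConnected) (eV : ∀ u, Nonempty (π'.VertexFiber u ≃ D.FV u))
    (eE : ∀ e, Nonempty (π'.EdgeFiber e ≃ D.FE e)) :
    Function.Bijective (fun w : G'.Vertex => (⟨π'.vertexMap w, ℓV w⟩ : Σ u, D.FV u)) ∧
      Function.Bijective (fun e' : G'.Edge => (⟨π'.edgeMap e', ℓE e'⟩ : Σ e, D.FE e)) := by
  obtain ⟨Θ, hΘ, hΘV, hΘE, hΘB⟩ := D.exists_hom_total_of_labels π' ℓV ℓE hcompat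
  have hcov : IsGraphCovering Θ :=
    ⟨D.isProper_of_comp_proj_eq π' hπ' Θ hΘ,
      D.isExcision_of_labels π' ℓV ℓE hcompat hinj hcard Θ hΘV hΘB⟩
  haveI : ∀ u, Finite (D.proj.VertexFiber u) := fun u => Finite.of_equiv _ (D.fibreVertexEquiv u).symm
  haveI : ∀ e, Finite (D.proj.EdgeFiber e) := fun e => Finite.of_equiv _ (D.fibreEdgeEquiv e).symm
  haveI : ∀ u, Finite (π'.VertexFiber u) := fun u => Finite.of_equiv _ (eV u).some.symm
  haveI : ∀ e, Finite (π'.EdgeFiber e) := fun e => Finite.of_equiv _ (eE e).some.symm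
  have hV : ∀ u, Nat.card (π'.VertexFiber u) = Nat.card (D.proj.VertexFiber u) := fun u =>
    (Nat.card_congr (eV u).some).trans (D.natCard_vertexFiber_proj u).symm
  have hE : ∀ e, Nat.card (π'.EdgeFiber e) = Nat.card (D.proj.EdgeFiber e) := fun e =>
    (Nat.card_congr (eE e).some).trans (D.natCard_edgeFiber_proj e).symm
  obtain ⟨hbV, hbE⟩ := hcov.bijective_of_natCard_fiber_eq hconn hΘ hV hE
  have h1 : (fun w : G'.Vertex => (⟨π'.vertexMap w, ℓV w⟩ : Σ u, D.FV u)) = Θ.vertexMap :=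
    funext fun w => (hΘV w).symm
  have h2 : (fun e' : G'.Edge => (⟨π'.edgeMap e', ℓE e'⟩ : Σ e, D.FE e)) = Θ.edgeMap :=
    funext fun e' => (hΘE e').symm
  rw [h1, h2]
  exact ⟨hbV, hbE⟩

end FibreData

end SemiGraph

end Literature.AnabelianGeometry.SemiGraphs
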